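import Summits.CriticalPhenomena.PercolationContinuityZ3.Theses.PercExchangeRateTransport

/-!
# `CurveInvariance` of route PercExchangeRateTransport (item stmt-CriticalPhenomena-16068) — PROVED

The crux `CurveInvariance` (the sixth binder `hCI` of the route's crux-only `closes`) is the
INSTANTIATION of the abstract `TransportLemma` on the label-coupled anisotropic family on
`ℤ²×ℤ`: `TransportLemma → SupercritExchangeUniformity → SubcritExchangeUniformity → ModelFacts →
CriticalCurveRegular → Grimmett1999_criticalProb_pos_lt_one → ∀ [lo,hi] ⊂ (0,1), ∀ t ∈ [lo,hi],
J t = J hi`, `J t = θ (pc t) t`.  Once `ModelFacts` is destructured the obligations are pure real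
analysis, cut (birth line, planner-skel-16068-0) into three percolation-free lemmas, all proved
here:

* `stub_collar` — compactness: a curve continuous on `[lo,hi]` with values in `(0,1)` keeps a
  uniform distance from `0` and `1` (`IsCompact.exists_isMinOn` / `exists_isMaxOn`);
* `stub_threshold` — the sharp-threshold property of `pc t = sInf ({p | 0 ≤ p ≤ 1 ∧ 0 < θ p t} ∪ {1})`
  for EVERY real `p` (order argument; `p < 0` and `p > 1` handled by `0 < pc t < 1`);
* `stub_gluedField` — the two-sided exchange-rate field by `max`-REPARAMETRISATION
  `a p t := a⁺ (max p (pc t)) t`: the seam identity `a⁺ (pc t) t = σ t` (both exchange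
  inequalities at `p = pc t`, `Dp > 0` there) makes it `σ t` below the curve, and continuity on
  the two-sided collar is `ContinuousOn.comp` along the retraction `x ↦ (max x.1 (pc x.2), x.2)`.

`curveInvariance_core` is the percolation-free composition (applies `TransportLemma`);
`curveInvariance_proof` concludes the route decl BY NAME (reads `Θ, θ, pc` off `ModelFacts` by
unification).  Self-contained: imports only the route file; no `def`, no `sorry`; axioms
`propext`, `Classical.choice`, `Quot.sound`.

Provenance: strategist file `Cruxes/CurveInvariance/Lines/max_reparam.lean`
(planner-cstrat-stmt-CriticalPhenomena-16068-b1-0, 2026-08-17), re-deriving the refuter's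
candidate proof (refuter-rattack-stmt-CriticalPhenomena-16068-0, evidence `CandidateProof.lean`)
on the birth skeleton (planner-skel-stmt-CriticalPhenomena-16068-0); landed verbatim from
`Cruxes/CurveInvariance/Lines/max_reparam_landing.lean` by the line lead
(prover-line-stmt-CriticalPhenomena-16068-0, line `Sketch` = idea `retraction-seam`).
-/

namespace Summit.CriticalPhenomena.PercolationContinuityZ3.Theorems.PercExchangeRateTransportCurveInvariance

open Summit.CriticalPhenomena.PercolationContinuityZ3.Theses.PercExchangeRateTransport

/-! ## §1 The three real-analysis lemmas (the birth cut), proved -/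

/-- **Stub 1 — COLLAR INSIDE THE SQUARE (compactness), proved.** A curve `pc` continuous on
`[lo,hi]` with `0 < pc t < 1` there is uniformly inside the open square. -/
theorem stub_collar :
    ∀ (pc : ℝ → ℝ) (lo hi : ℝ), lo ≤ hi → ContinuousOn pc (Set.Icc lo hi) →
      (∀ t ∈ Set.Icc lo hi, 0 < pc t ∧ pc t < 1) →
      ∃ ρ > (0 : ℝ), ∀ t ∈ Set.Icc lo hi, ρ < pc t ∧ pc t + ρ < 1 := by
  intro pc lo hi hle hpc hb
  obtain ⟨t₁, ht₁, hmin⟩ :=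
    (isCompact_Icc : IsCompact (Set.Icc lo hi)).exists_isMinOn (Set.nonempty_Icc.mpr hle) hpc
  obtain ⟨t₂, ht₂, hmax⟩ :=
    (isCompact_Icc : IsCompact (Set.Icc lo hi)).exists_isMaxOn (Set.nonempty_Icc.mpr hle) hpc
  rw [isMinOn_iff] at hmin
  rw [isMaxOn_iff] at hmax
  have h1 : 0 < pc t₁ := (hb t₁ ht₁).1
  have h2 : pc t₂ < 1 := (hb t₂ ht₂).2
  have hm0 : 0 < min (pc t₁) (1 - pc t₂) := lt_min h1 (by linarith)
  refine ⟨min (pc t₁) (1 - pc t₂) / 2, by linarith, ?_⟩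
  intro t ht
  have hlo' : pc t₁ ≤ pc t := hmin t ht
  have hhi' : pc t ≤ pc t₂ := hmax t ht
  have hm1 : min (pc t₁) (1 - pc t₂) ≤ pc t₁ := min_le_left _ _
  have hm2 : min (pc t₁) (1 - pc t₂) ≤ 1 - pc t₂ := min_le_right _ _
  constructor <;> linarith

/-- **Stub 2 — SHARP THRESHOLD FROM THE `sInf` DEFINITION (all real `p`), proved.** -/
theorem stub_threshold :
    ∀ (Θ : ℕ → ℝ → ℝ → ℝ) (θ : ℝ → ℝ → ℝ) (pc : ℝ → ℝ) (t : ℝ),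
      (∀ n, Monotone (fun p => Θ n p t)) → (∀ n p, 0 ≤ Θ n p t) →
      (∀ p, θ p t = ⨅ n, Θ n p t) →
      pc t = sInf ({p : ℝ | 0 ≤ p ∧ p ≤ 1 ∧ 0 < θ p t} ∪ {1}) →
      0 < pc t → pc t < 1 →
      ∀ p : ℝ, (p < pc t → (⨅ n, Θ n p t) = 0) ∧ (pc t < p → 0 < ⨅ n, Θ n p t) := by
  intro Θ θ pc t hmono hnn hinf hpc hpos hlt1 p
  set S : Set ℝ := {p : ℝ | 0 ≤ p ∧ p ≤ 1 ∧ 0 < θ p t} ∪ {1} with hS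
  have hbdd : BddBelow S := by
    refine ⟨0, ?_⟩
    rintro q hq
    rw [hS] at hq
    rcases hq with hq | hq
    · exact hq.1
    · rw [Set.mem_singleton_iff] at hq
      rw [hq]
      norm_num
  have hSne : S.Nonempty := ⟨1, by rw [hS]; exact Or.inr rfl⟩
  have hθnn : ∀ q : ℝ, 0 ≤ ⨅ n, Θ n q t := fun q => le_ciInf fun n => hnn n q
  have hθmono : ∀ q r : ℝ, q ≤ r → (⨅ n, Θ n q t) ≤ ⨅ n, Θ n r t := by
    intro q r hqr
    refine ciInf_mono ⟨0, ?_⟩ fun n => hmono n hqr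
    rintro _ ⟨n, rfl⟩
    exact hnn n q
  constructor
  · intro hp
    have hq : max p 0 < pc t := max_lt hp hpos
    have hq1 : max p 0 ≤ 1 := le_of_lt (lt_trans hq hlt1)
    have hθq : (⨅ n, Θ n (max p 0) t) = 0 := by
      by_contra hne
      have hposq : 0 < θ (max p 0) t := by
        rw [hinf]
        exact lt_of_le_of_ne (hθnn _) (Ne.symm hne)
      have hmem : max p 0 ∈ S := by
        rw [hS]
        exact Or.inl ⟨le_max_right _ _, hq1, hposq⟩
      have hle : pc t ≤ max p 0 := by
        rw [hpc]
        exact csInf_le hbdd hmem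
      linarith
    refine le_antisymm ?_ (hθnn p)
    calc (⨅ n, Θ n p t) ≤ ⨅ n, Θ n (max p 0) t := hθmono _ _ (le_max_left _ _)
      _ = 0 := hθq
  · intro hp
    have hlt : sInf S < min p 1 := by
      rw [← hpc]
      exact lt_min hp hlt1
    obtain ⟨r, hrS, hr⟩ := exists_lt_of_csInf_lt hSne hlt
    have hr1 : r < 1 := lt_of_lt_of_le hr (min_le_right _ _)
    have hrp : r < p := lt_of_lt_of_le hr (min_le_left _ _)
    rw [hS] at hrS
    rcases hrS with hrS | hrS
    · obtain ⟨-, -, hθr⟩ := hrS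
      rw [hinf] at hθr
      exact lt_of_lt_of_le hθr (hθmono _ _ hrp.le)
    · rw [Set.mem_singleton_iff] at hrS
      rw [hrS] at hr1
      exact absurd hr1 (lt_irrefl _)

/-- **Stub 3 — GLUED EXCHANGE-RATE FIELD (the load-bearing stub), proved by
`max`-reparametrisation.** The two-sided field is `a p t := a⁺ (max p (pc t)) t`; the seam
identity `a⁺ (pc t) t = σ t` (forced by the two exchange inequalities at `p = pc t` and
`Dp > 0` there) makes it equal to `σ t` below the curve; continuity on the two-sided collar is
`ContinuousOn.comp` along the retraction `x ↦ (max x.1 (pc x.2), x.2)` into the right collar. -/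
theorem stub_gluedField :
    ∀ (Dt Dp : ℕ → ℝ → ℝ → ℝ) (pc : ℝ → ℝ) (lo hi ρ₀ : ℝ),
      lo ≤ hi → 0 < ρ₀ → ContinuousOn pc (Set.Icc lo hi) →
      (∀ t ∈ Set.Icc lo hi, ρ₀ < pc t ∧ pc t + ρ₀ < 1) →
      (∀ t ∈ Set.Icc lo hi, ∀ n : ℕ, 1 ≤ n → 0 < Dp n (pc t) t) →
      (∃ ρ > (0 : ℝ), ∃ L : ℝ, ∃ a : ℝ → ℝ → ℝ,
        ContinuousOn (fun x : ℝ × ℝ => a x.1 x.2)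
            {x : ℝ × ℝ | x.2 ∈ Set.Icc lo hi ∧ pc x.2 ≤ x.1 ∧ x.1 ≤ pc x.2 + ρ} ∧
          (∀ t ∈ Set.Icc lo hi, ∀ p q : ℝ, pc t ≤ p → p ≤ pc t + ρ → pc t ≤ q → q ≤ pc t + ρ →
            |a p t - a q t| ≤ L * |p - q|) ∧
          ∀ η > (0 : ℝ), ∃ m : ℕ, ∀ n ≥ m, ∀ t ∈ Set.Icc lo hi, ∀ p : ℝ, pc t ≤ p →
            p ≤ pc t + ρ → |Dt n p t - a p t * Dp n p t| ≤ η * Dp n p t) →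
      (∃ σ : ℝ → ℝ, ContinuousOn σ (Set.Icc lo hi) ∧
          ∀ η > (0 : ℝ), ∃ δ > (0 : ℝ), ∃ m : ℕ, ∀ n ≥ m, ∀ t ∈ Set.Icc lo hi, ∀ p : ℝ,
            pc t - δ ≤ p → p ≤ pc t → |Dt n p t - σ t * Dp n p t| ≤ η * Dp n p t) →
      ∃ ρ > (0 : ℝ), ∃ L : ℝ, ∃ a : ℝ → ℝ → ℝ, ρ ≤ ρ₀ ∧
        ContinuousOn (fun x : ℝ × ℝ => a x.1 x.2)
            {x : ℝ × ℝ | x.2 ∈ Set.Icc lo hi ∧ |x.1 - pc x.2| ≤ ρ} ∧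
          (∀ t ∈ Set.Icc lo hi, ∀ p q : ℝ, pc t ≤ p → p ≤ pc t + ρ → pc t ≤ q → q ≤ pc t + ρ →
            |a p t - a q t| ≤ L * |p - q|) ∧
          ∀ η > (0 : ℝ), ∃ δ > (0 : ℝ), ∃ m : ℕ, ∀ n ≥ m, ∀ t ∈ Set.Icc lo hi, ∀ p : ℝ,
            pc t - δ ≤ p → p ≤ pc t + ρ → |Dt n p t - a p t * Dp n p t| ≤ η * Dp n p t := by
  intro Dt Dp pc lo hi ρ₀ _hle hρ₀ hpcc _hsq hpos hKp hKm
  obtain ⟨ρ, hρ, L, ap, hcont, hlip, hex⟩ := hKp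
  obtain ⟨σ, _hσ, hexm⟩ := hKm
  -- FIRST LEMMA OF THE LINE: the seam identity on the curve, forced by positivity of `Dp`.
  have seam : ∀ t ∈ Set.Icc lo hi, ap (pc t) t = σ t := by
    intro t ht
    apply eq_of_forall_dist_le
    intro ε hε
    have hη : (0 : ℝ) < ε / 2 := half_pos hε
    obtain ⟨m₁, hm₁⟩ := hex (ε / 2) hη
    obtain ⟨δ, hδ, m₂, hm₂⟩ := hexm (ε / 2) hη
    have hn1 : m₁ ≤ max (max m₁ m₂) 1 := le_trans (le_max_left _ _) (le_max_left _ _)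
    have hn2 : m₂ ≤ max (max m₁ m₂) 1 := le_trans (le_max_right _ _) (le_max_left _ _)
    have hn3 : 1 ≤ max (max m₁ m₂) 1 := le_max_right _ _
    have hD : 0 < Dp (max (max m₁ m₂) 1) (pc t) t := hpos t ht _ hn3
    have h1 := hm₁ _ hn1 t ht (pc t) le_rfl (by linarith)
    have h2 := hm₂ _ hn2 t ht (pc t) (by linarith) le_rfl
    obtain ⟨h1a, h1b⟩ := abs_le.mp h1
    obtain ⟨h2a, h2b⟩ := abs_le.mp h2
    have hid : (ap (pc t) t - σ t) * Dp (max (max m₁ m₂) 1) (pc t) t =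
        (Dt (max (max m₁ m₂) 1) (pc t) t - σ t * Dp (max (max m₁ m₂) 1) (pc t) t) -
          (Dt (max (max m₁ m₂) 1) (pc t) t - ap (pc t) t * Dp (max (max m₁ m₂) 1) (pc t) t) := by
      ring
    have hub : (ap (pc t) t - σ t) * Dp (max (max m₁ m₂) 1) (pc t) t ≤
        ε * Dp (max (max m₁ m₂) 1) (pc t) t := by
      rw [hid]; linarith
    have hlb : (-ε) * Dp (max (max m₁ m₂) 1) (pc t) t ≤
        (ap (pc t) t - σ t) * Dp (max (max m₁ m₂) 1) (pc t) t := by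
      rw [hid]; linarith
    rw [Real.dist_eq]
    exact abs_le.mpr ⟨le_of_mul_le_mul_right hlb hD, le_of_mul_le_mul_right hub hD⟩
  refine ⟨min ρ ρ₀, lt_min hρ hρ₀, L, fun p t => ap (max p (pc t)) t, min_le_right _ _,
    ?_, ?_, ?_⟩
  · -- continuity on the two-sided collar: reparametrise by `max` into the right collar
    have h1 : ContinuousOn (fun x : ℝ × ℝ => pc x.2)
        {x : ℝ × ℝ | x.2 ∈ Set.Icc lo hi ∧ |x.1 - pc x.2| ≤ min ρ ρ₀} :=
      hpcc.comp continuousOn_snd fun x hx => hx.1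
    have hφ1 : ContinuousOn (fun x : ℝ × ℝ => max x.1 (pc x.2))
        {x : ℝ × ℝ | x.2 ∈ Set.Icc lo hi ∧ |x.1 - pc x.2| ≤ min ρ ρ₀} :=
      continuous_max.comp_continuousOn (continuousOn_fst.prodMk h1)
    have hφ : ContinuousOn (fun x : ℝ × ℝ => (max x.1 (pc x.2), x.2))
        {x : ℝ × ℝ | x.2 ∈ Set.Icc lo hi ∧ |x.1 - pc x.2| ≤ min ρ ρ₀} :=
      hφ1.prodMk continuousOn_snd
    have hmaps : Set.MapsTo (fun x : ℝ × ℝ => (max x.1 (pc x.2), x.2))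
        {x : ℝ × ℝ | x.2 ∈ Set.Icc lo hi ∧ |x.1 - pc x.2| ≤ min ρ ρ₀}
        {x : ℝ × ℝ | x.2 ∈ Set.Icc lo hi ∧ pc x.2 ≤ x.1 ∧ x.1 ≤ pc x.2 + ρ} := by
      rintro ⟨p, t⟩ ⟨ht, hpt⟩
      simp only [Set.mem_setOf_eq] at ht hpt ⊢
      have h3 : p - pc t ≤ min ρ ρ₀ := (abs_le.mp hpt).2
      have h4 : min ρ ρ₀ ≤ ρ := min_le_left _ _
      exact ⟨ht, le_max_right _ _, max_le (by linarith) (by linarith)⟩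
    exact hcont.comp hφ hmaps
  · -- Lipschitz in `p` on the right half, where the field is `a⁺` itself
    intro t ht p q hp hpρ hq hqρ
    have h4 : min ρ ρ₀ ≤ ρ := min_le_left _ _
    show |ap (max p (pc t)) t - ap (max q (pc t)) t| ≤ L * |p - q|
    rw [max_eq_left hp, max_eq_left hq]
    exact hlip t ht p q hp (by linarith) hq (by linarith)
  · -- the exchange inequality on the glued domain, by cases on the side of the curve
    intro η hη
    obtain ⟨m₁, hm₁⟩ := hex η hη
    obtain ⟨δ, hδ, m₂, hm₂⟩ := hexm η hη
    refine ⟨δ, hδ, max m₁ m₂, ?_⟩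
    intro n hn t ht p hp1 hp2
    have hn1 : m₁ ≤ n := le_trans (le_max_left _ _) hn
    have hn2 : m₂ ≤ n := le_trans (le_max_right _ _) hn
    have h4 : min ρ ρ₀ ≤ ρ := min_le_left _ _
    show |Dt n p t - ap (max p (pc t)) t * Dp n p t| ≤ η * Dp n p t
    by_cases h : pc t ≤ p
    · rw [max_eq_left h]
      exact hm₁ n hn1 t ht p h (by linarith)
    · push Not at h
      rw [max_eq_right h.le, seam t ht]
      exact hm₂ n hn2 t ht p hp1 h.le

/-! ## §2 The percolation-free composition core (birth line) -/

/-- The percolation-free core of the instantiation (birth line, planner-skel-16068-0): for an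
abstract family `Θ n p t` with `θ = ⨅ n, Θ n`, threshold curve `pc` (the `sInf` formula), the
`ModelFacts`-type regularity, the `CriticalCurveRegular`-type continuity and bounds of `pc` on
`(0,1)`, and the K⁺ / K⁻ data, the three stub statements and `TransportLemma` make
`t ↦ θ (pc t) t` constant on every compact sub-arc. -/
theorem curveInvariance_core
    {Θ : ℕ → ℝ → ℝ → ℝ} {θ : ℝ → ℝ → ℝ} {pc : ℝ → ℝ}
    (hCollar : ∀ (pc : ℝ → ℝ) (lo hi : ℝ), lo ≤ hi → ContinuousOn pc (Set.Icc lo hi) →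
      (∀ t ∈ Set.Icc lo hi, 0 < pc t ∧ pc t < 1) →
      ∃ ρ > (0 : ℝ), ∀ t ∈ Set.Icc lo hi, ρ < pc t ∧ pc t + ρ < 1)
    (hThr : ∀ (Θ : ℕ → ℝ → ℝ → ℝ) (θ : ℝ → ℝ → ℝ) (pc : ℝ → ℝ) (t : ℝ),
      (∀ n, Monotone (fun p => Θ n p t)) → (∀ n p, 0 ≤ Θ n p t) →
      (∀ p, θ p t = ⨅ n, Θ n p t) →
      pc t = sInf ({p : ℝ | 0 ≤ p ∧ p ≤ 1 ∧ 0 < θ p t} ∪ {1}) →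
      0 < pc t → pc t < 1 →
      ∀ p : ℝ, (p < pc t → (⨅ n, Θ n p t) = 0) ∧ (pc t < p → 0 < ⨅ n, Θ n p t))
    (hGlue : ∀ (Dt Dp : ℕ → ℝ → ℝ → ℝ) (pc : ℝ → ℝ) (lo hi ρ₀ : ℝ),
      lo ≤ hi → 0 < ρ₀ → ContinuousOn pc (Set.Icc lo hi) →
      (∀ t ∈ Set.Icc lo hi, ρ₀ < pc t ∧ pc t + ρ₀ < 1) →
      (∀ t ∈ Set.Icc lo hi, ∀ n : ℕ, 1 ≤ n → 0 < Dp n (pc t) t) →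
      (∃ ρ > (0 : ℝ), ∃ L : ℝ, ∃ a : ℝ → ℝ → ℝ,
        ContinuousOn (fun x : ℝ × ℝ => a x.1 x.2)
            {x : ℝ × ℝ | x.2 ∈ Set.Icc lo hi ∧ pc x.2 ≤ x.1 ∧ x.1 ≤ pc x.2 + ρ} ∧
          (∀ t ∈ Set.Icc lo hi, ∀ p q : ℝ, pc t ≤ p → p ≤ pc t + ρ → pc t ≤ q → q ≤ pc t + ρ →
            |a p t - a q t| ≤ L * |p - q|) ∧
          ∀ η > (0 : ℝ), ∃ m : ℕ, ∀ n ≥ m, ∀ t ∈ Set.Icc lo hi, ∀ p : ℝ, pc t ≤ p →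
            p ≤ pc t + ρ → |Dt n p t - a p t * Dp n p t| ≤ η * Dp n p t) →
      (∃ σ : ℝ → ℝ, ContinuousOn σ (Set.Icc lo hi) ∧
          ∀ η > (0 : ℝ), ∃ δ > (0 : ℝ), ∃ m : ℕ, ∀ n ≥ m, ∀ t ∈ Set.Icc lo hi, ∀ p : ℝ,
            pc t - δ ≤ p → p ≤ pc t → |Dt n p t - σ t * Dp n p t| ≤ η * Dp n p t) →
      ∃ ρ > (0 : ℝ), ∃ L : ℝ, ∃ a : ℝ → ℝ → ℝ, ρ ≤ ρ₀ ∧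
        ContinuousOn (fun x : ℝ × ℝ => a x.1 x.2)
            {x : ℝ × ℝ | x.2 ∈ Set.Icc lo hi ∧ |x.1 - pc x.2| ≤ ρ} ∧
          (∀ t ∈ Set.Icc lo hi, ∀ p q : ℝ, pc t ≤ p → p ≤ pc t + ρ → pc t ≤ q → q ≤ pc t + ρ →
            |a p t - a q t| ≤ L * |p - q|) ∧
          ∀ η > (0 : ℝ), ∃ δ > (0 : ℝ), ∃ m : ℕ, ∀ n ≥ m, ∀ t ∈ Set.Icc lo hi, ∀ p : ℝ,
            pc t - δ ≤ p → p ≤ pc t + ρ → |Dt n p t - a p t * Dp n p t| ≤ η * Dp n p t)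
    (hT : TransportLemma)
    (hinf : ∀ p t, θ p t = ⨅ n, Θ n p t)
    (hpc : ∀ t, pc t = sInf ({p : ℝ | 0 ≤ p ∧ p ≤ 1 ∧ 0 < θ p t} ∪ {1}))
    (hC1 : ∀ n, ContDiffOn ℝ 1 (fun x : ℝ × ℝ => Θ n x.1 x.2) (Set.Ioo 0 1 ×ˢ Set.Ioo 0 1))
    (hmp : ∀ n t, Monotone (fun p => Θ n p t))
    (hmt : ∀ n p, Monotone (fun t => Θ n p t))
    (hanti : ∀ p t, Antitone (fun n => Θ n p t))
    (h01 : ∀ n p t, 0 ≤ Θ n p t ∧ Θ n p t ≤ 1)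
    (hDpos : ∀ n, 1 ≤ n → ∀ p ∈ Set.Ioo (0 : ℝ) 1, ∀ t ∈ Set.Ioo (0 : ℝ) 1,
      0 < deriv (fun q => Θ n q t) p)
    (hpcc : ContinuousOn pc (Set.Ioo 0 1))
    (hpcb : ∀ t ∈ Set.Ioo (0 : ℝ) 1, 0 < pc t ∧ pc t < 1)
    (hSup : ∀ lo hi : ℝ, 0 < lo → lo < hi → hi < 1 → ∃ ρ > (0 : ℝ), ∃ L : ℝ, ∃ a : ℝ → ℝ → ℝ,
      ContinuousOn (fun x : ℝ × ℝ => a x.1 x.2)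
          {x : ℝ × ℝ | x.2 ∈ Set.Icc lo hi ∧ pc x.2 ≤ x.1 ∧ x.1 ≤ pc x.2 + ρ} ∧
        (∀ t ∈ Set.Icc lo hi, ∀ p q : ℝ, pc t ≤ p → p ≤ pc t + ρ → pc t ≤ q → q ≤ pc t + ρ →
          |a p t - a q t| ≤ L * |p - q|) ∧
        ∀ η > (0 : ℝ), ∃ m : ℕ, ∀ n ≥ m, ∀ t ∈ Set.Icc lo hi, ∀ p : ℝ, pc t ≤ p →
          p ≤ pc t + ρ →
          |deriv (fun s => Θ n p s) t - a p t * deriv (fun q => Θ n q t) p| ≤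
            η * deriv (fun q => Θ n q t) p)
    (hSub : ∀ lo hi : ℝ, 0 < lo → lo < hi → hi < 1 → ∃ σ : ℝ → ℝ,
      ContinuousOn σ (Set.Icc lo hi) ∧
        ∀ η > (0 : ℝ), ∃ δ > (0 : ℝ), ∃ m : ℕ, ∀ n ≥ m, ∀ t ∈ Set.Icc lo hi, ∀ p : ℝ,
          pc t - δ ≤ p → p ≤ pc t →
          |deriv (fun s => Θ n p s) t - σ t * deriv (fun q => Θ n q t) p| ≤
            η * deriv (fun q => Θ n q t) p) :
    ∀ lo hi : ℝ, 0 < lo → lo < hi → hi < 1 → ∀ t ∈ Set.Icc lo hi, θ (pc t) t = θ (pc hi) hi := by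
  intro lo hi hlo hlohi hhi t ht
  have hIcc : ∀ s ∈ Set.Icc lo hi, s ∈ Set.Ioo (0 : ℝ) 1 := fun s hs =>
    ⟨hlo.trans_le hs.1, lt_of_le_of_lt hs.2 hhi⟩
  have hpcc' : ContinuousOn pc (Set.Icc lo hi) := hpcc.mono fun s hs => hIcc s hs
  have hpcb' : ∀ s ∈ Set.Icc lo hi, 0 < pc s ∧ pc s < 1 := fun s hs => hpcb s (hIcc s hs)
  obtain ⟨ρ₀, hρ₀, hρ₀b⟩ := hCollar pc lo hi hlohi.le hpcc' hpcb'
  have hpos : ∀ s ∈ Set.Icc lo hi, ∀ n : ℕ, 1 ≤ n → 0 < deriv (fun q => Θ n q s) (pc s) :=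
    fun s hs n hn => hDpos n hn (pc s) (hpcb' s hs) s (hIcc s hs)
  obtain ⟨ρ, hρ, L, a, hρle, hcont, hlip, hexch⟩ :=
    hGlue (fun n p t => deriv (fun s => Θ n p s) t) (fun n p t => deriv (fun q => Θ n q t) p)
      pc lo hi ρ₀ hlohi.le hρ₀ hpcc' hρ₀b hpos (hSup lo hi hlo hlohi hhi) (hSub lo hi hlo hlohi hhi)
  have hin : ∀ s ∈ Set.Icc lo hi, ρ < pc s ∧ pc s + ρ < 1 := fun s hs =>
    ⟨lt_of_le_of_lt hρle (hρ₀b s hs).1, by linarith [(hρ₀b s hs).2]⟩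
  have hthr : ∀ s ∈ Set.Icc lo hi, ∀ p : ℝ,
      (p < pc s → (⨅ n, Θ n p s) = 0) ∧ (pc s < p → 0 < ⨅ n, Θ n p s) := fun s hs =>
    hThr Θ θ pc s (fun n => hmp n s) (fun n p => (h01 n p s).1) (fun p => hinf p s) (hpc s)
      (hpcb' s hs).1 (hpcb' s hs).2
  have key := hT Θ pc a lo hi ρ L hlo hlohi hhi hρ hC1 hmp hmt hanti (fun n p t => (h01 n p t).1)
    hpcc' hin hthr hcont hlip hexch t ht
  rw [hinf, hinf]
  exact key

/-! ## §3 The crux -/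

/-- **`CurveInvariance` holds.** Unfold the crux, read `Θ`, `θ`, `pc` off `ModelFacts` by
unification, and apply the percolation-free core fed with the three proved lemmas.  The crux's
sixth hypothesis `Grimmett1999_criticalProb_pos_lt_one` is not needed.  Its type is literally the
route decl `…Theses.PercExchangeRateTransport.CurveInvariance`. -/
theorem curveInvariance_proof :
    Summit.CriticalPhenomena.PercolationContinuityZ3.Theses.PercExchangeRateTransport.CurveInvariance := by
  intro hT hSup hSub hMF hCC _hPc
  obtain ⟨-, h2, h3, h4, h5, h6, h7, h8, -, -⟩ := hMF
  obtain ⟨hcc1, hcc2⟩ := hCC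
  exact curveInvariance_core stub_collar stub_threshold stub_gluedField hT h7 (fun _ => rfl) h2 h3
    h4 h5 h6 h8 hcc1 hcc2 hSup hSub

end Summit.CriticalPhenomena.PercolationContinuityZ3.Theorems.PercExchangeRateTransportCurveInvariance
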